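/-
Copyright (c) 2026 the pub-hodgecm-mathlib formalisation cell (harness21).  Prover seat hodgecm-mathlib-LH4-p10 (g6): Track A «(D-RAM) FOUR-FRAME» squad of crux H413, STAGE-1b,
(β-BAL) road — dealer LH4-plan (g13) WORD #82 (B) «B2a-2», LH4-p11 (g8) SIG `SIG-B2a2-labelledOddFibre.v1` dbcde430.  2026-09-04.
-/
import Summits.HodgeConjecture.HodgeConjecture.Theorems.F0P3cDyRamDiagonalLabelledOddFibreClasses -- FILE 2∕3 (this seat): the classes modulo `N(S̃)` from the orbit + the index identity; brings FILE 1∕3, the DEFS leaf (LH4-p11), ★ (Oκ2b)'s imports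
import Mathlib.Tactic.FieldSimp
import HarnessLib

/-!
# Crux `H413`, line LH4 «(D-RAM) FOUR-FRAME» — (β-BAL) road, brick B2a-2: THE LABELLED-ODD FIBRE IDENTITY ALONG A UNIT-TORUS ORBIT

Cell `hodgecm-mathlib` (D-0151), FLOOR 0, crux item H413 = `stmt-HodgeConjecture-24833`, route `HCCMUnconditional`; squad F0∕P3c∕LH4.  THEOREMS ONLY; lane
`--supports stmt-HodgeConjecture-24833 --as helper` (count-neutral).

WHAT.  The twin of ★ (Oκ2b) `F0P3cDyRamDiagonalKappaOrbitFibreCount.sum_signChar_mul_finsum_ncard_fibre_mul_relIndex_eq` with a TORUS-EQUIVARIANT LABEL `Λ` on (lattice, form)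
pairs (`Λ(diag(z)M, D) ↔ Λ(M, D·N(z))`, LH4-p11 (g8)'s DEFS `IsTorusEquivariantLabel`): along the unit-torus orbit of `M₀`,
`(Σ_e (−1)^{e_i} · Σᶠ_{M ∈ 𝒯·M₀} #{a : diag(ϖu^a)M is a type-tv vertex of diag(d_e) ∧ Λ(diag(ϖu^a)M, d_e)}) · [𝒰 : N(S̃(M₀) ∩ 𝒯)] = 8 · [𝒯 : S̃(M₀) ∩ 𝒯] · labelledOddCount σ ϖ tv i Λ M₀`
— statement = LH4-p11 (g8) SIG (B2a-2) v1 §1 TOKEN FOR TOKEN.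
FILES.  1∕3 `…LabelledOddFibreStep` (Steps 1–4 with the label), 2∕3 `…LabelledOddFibreClasses` (classes + index), 3∕3 THIS HEAD.
PROOF.  ★ (O2b) Steps 1–4 with the label riding along (by `hΛ` at `z = ϖu^a·u` the labelled fibre over `diag(u)M₀` is `{a₀}` iff `s(e,u) := d_e·N(u)·w⁻¹ ∈ S_F(M₀)` AND
`Λ M₀ (D₁·s(e,u))`, a condition constant on the `S̃`-coset of `u`); then, with `H := 𝒯 ⊓ N⁻¹(S_F)`, `H₀ := 𝒯 ⊓ N⁻¹(N S̃)` (`S̃ ≤ H₀ ≤ H`): for a good `e` the labelled orbit set is a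
disjoint union over the `H₀`-cosets `h̄` of `H` with `Λ M₀ (D₁·s₀(e)·N h)` of translates of the `H₀`-orbit, each of size `[H₀ : S̃]`; the pairs `(e good, h̄)` are in bijection with
`polarisationNormClasses σ ϖ tv M₀` (classes `D·N(S̃)`), on which the sign is `ω(D_i) = (−1)^{e_i}` (norms are `ω`-trivial) and `Λ` is constant — so the signed labelled count
is `[H₀ : S̃] · labelledOddCount`; finally `[H₀ : S̃]·[𝒰 : N S̃] = 8·[𝒯 : S̃]` (`N : 𝒯∕H₀ ≅ N𝒯∕N S̃`, ★ `h8`).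
HONEST LABEL.  Count-neutral; pays no tier-0 row (the eightfold vanishing ∕ (β-BAL) ∕ `stub_law_cleanSgn` stay OPEN until LH4-p11's B2a-3 and LH4-p05's END land); `HC_CM`
is proved only modulo the 7 printed citations (2 remaining named inputs: hLiu418 = `stmt-HodgeConjecture-24832`, h413 = `stmt-HodgeConjecture-24833`) until rung 0 closes.

## References
* [Kottwitz1986BaseChangeUnits] R. E. Kottwitz, *Base change for unit elements of Hecke algebras*, Compositio Math. 60 (1986), §1 pp. 240–241.
* [Rogawski1990] J. D. Rogawski, *Automorphic Representations of Unitary Groups in Three Variables*, Ann. of Math. Stud. 123 (1990), §4.9 Prop. 4.9.1 (a)(b) p. 55, §4.10 p. 58.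
* [LanglandsShelstad1987] R. P. Langlands, D. Shelstad, *On the definition of transfer factors*, Math. Ann. 278 (1987), §3.
* [Serre1979] J.-P. Serre, *Local Fields*, GTM 67 (1979), Ch. V §3 Cor. 3.
-/

set_option autoImplicit false

noncomputable section

namespace Summit.HodgeConjecture.HodgeConjecture.Cruxes.H413.F0P3cDyRamDiagonalLabelledOddFibreCount

open Literature.NumberTheory.Automorphic Literature.NumberTheory.Automorphic.HermitianLattice
open Literature.NumberTheory.Automorphic.UnitaryLatticeTree Literature.NumberTheory.Automorphic.UnitaryThreeFourFrame
open Summit.HodgeConjecture.HodgeConjecture.Cruxes.H413.F0P3cDyRamDiagonalTorusDefs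
open Summit.HodgeConjecture.HodgeConjecture.Cruxes.H413.F0P3cDyRamDiagonalOrbitFibreTransport
open Summit.HodgeConjecture.HodgeConjecture.Cruxes.H413.F0P3cDyRamTorusRepresentativesCount
open Summit.HodgeConjecture.HodgeConjecture.Cruxes.H413.F0P3cDyRamDiagonalPairReindex
open Summit.HodgeConjecture.HodgeConjecture.Cruxes.H413.F0P3cDyRamDiagonalOrbitFibreCount
open Summit.HodgeConjecture.HodgeConjecture.Cruxes.H413.F0P3cDyRamDiagonalKappaCountEval (normSign_ite_mul_norm)
open Summit.HodgeConjecture.HodgeConjecture.Cruxes.H413.F0P3cDyRamLabelledOddCountDefs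
open Summit.HodgeConjecture.HodgeConjecture.Cruxes.H413.F0P3cDyRamDiagonalLabelledOddFibreStep
open Summit.HodgeConjecture.HodgeConjecture.Cruxes.H413.F0P3cDyRamDiagonalLabelledOddFibreClasses
open scoped Valued WithZero Matrix MatrixGroups

variable {K : Type} [Field K] [Valued K ℤᵐ⁰]

/-- **(B2a-2) THE LABELLED-ODD FIBRE IDENTITY ALONG A UNIT-TORUS ORBIT** (LH4-p11 (g8) SIG v1 §1 verbatim): `σ` an isometric involution, `|ϖ| = exp(−1)` with unit avatar `ϖu`,
`c` a `σ`-fixed NON-NORM unit with the (NI2) dichotomy, `M₀` with FINITE unit-torus orbit, `tv` a type with the one-coset property `hcoset`, `Λ` a TORUS-EQUIVARIANT label.  Then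
for every slot `i`: `(Σ_e (−1)^{e_i}·Σᶠ_{M ∈ 𝒯·M₀} #{a : diag(ϖu^a)M type-tv vertex of diag(d_e) ∧ Λ(diag(ϖu^a)M, d_e)})·[𝒰 : N(S̃ ∩ 𝒯)] = 8·[𝒯 : S̃ ∩ 𝒯]·labelledOddCount`.
[cite: Kottwitz1986BaseChangeUnits, §1 pp. 240–241] [cite: Rogawski1990, §4.9 Prop. 4.9.1 (a)(b) p. 55; §4.10 p. 58] [cite: LanglandsShelstad1987, §3] -/
theorem sum_sign_mul_finsum_ncard_fibre_sepAt_mul_relIndex_eq {σ : K →+* K} (hσ : ∀ x, σ (σ x) = x) (hvσ : ∀ a, Valued.v (σ a) = Valued.v a)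
    {ϖ : K} (hϖ : Valued.v ϖ = WithZero.exp (-1 : ℤ)) (ϖu : Kˣ) (hϖu : (ϖu : K) = ϖ)
    {c : K} (hσc : σ c = c) (hcv : Valued.v c = 1) (hc : ¬ ∃ z : K, z * σ z = c)
    (hdich : ∀ x : K, σ x = x → x ≠ 0 → (∃ z : K, z * σ z = x) ∨ ∃ z : K, z * σ z = c * x)
    {M₀ : Submodule 𝒪[K] (Fin 3 → K)}
    (hfin : {M : Submodule 𝒪[K] (Fin 3 → K) | ∃ u ∈ unitTorus K 3, M = mapGL (diagGLUnits u) M₀}.Finite) (tv : ℕ)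
    (hcoset : ∀ D₁ : Fin 3 → K, (∀ i, σ (D₁ i) = D₁ i ∧ D₁ i ≠ 0) → IsVertexLattice σ ϖ (Matrix.diagonal D₁) tv M₀ →
      ∀ D : Fin 3 → K, (∀ i, σ (D i) = D i ∧ D i ≠ 0) →
        (IsVertexLattice σ ϖ (Matrix.diagonal D) tv M₀ ↔ ∃ u ∈ fixedUnitStabilizer σ M₀, ∀ i, D i = D₁ i * (u i : Kˣ)))
    (Λ : Submodule 𝒪[K] (Fin 3 → K) → (Fin 3 → K) → Prop) (hΛ : IsTorusEquivariantLabel σ Λ) (i : Fin 3) :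
    (∑ e : Fin 3 → Bool, ((if e i then (-1 : ℤ) else 1 : ℤ) : ℚ) *
        ((∑ᶠ M ∈ {M : Submodule 𝒪[K] (Fin 3 → K) | ∃ u ∈ unitTorus K 3, M = mapGL (diagGLUnits u) M₀},
          ({a : Fin 3 → ℤ | IsVertexLattice σ ϖ (Matrix.diagonal fun j => if e j then c else (1 : K)) tv
              (mapGL (diagGLUnits fun j => ϖu ^ a j) M) ∧
            Λ (mapGL (diagGLUnits fun j => ϖu ^ a j) M) (fun j => if e j then c else (1 : K))} : Set _).ncard : ℕ) : ℚ)) *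
      ((((unitStabilizer M₀).map (unitNormMap σ 3)).relIndex (fixedUnitTorus σ 3) : ℕ) : ℚ) =
    8 * (((unitStabilizer M₀).relIndex (unitTorus K 3) : ℕ) : ℚ) * (labelledOddCount σ ϖ tv i Λ M₀ : ℚ) := by
  classical
  have hc0 : c ≠ 0 := fun h => by simp [h] at hcv
  set Orb : Set (Submodule 𝒪[K] (Fin 3 → K)) := {M | ∃ u ∈ unitTorus K 3, M = mapGL (diagGLUnits u) M₀} with hOrb
  -- OFF THE POLARISABLE SET: every labelled fibre is empty and `labelledOddCount = 0`
  by_cases hex : ∃ D₁ : Fin 3 → K, (∀ i, σ (D₁ i) = D₁ i ∧ D₁ i ≠ 0) ∧ IsVertexLattice σ ϖ (Matrix.diagonal D₁) tv M₀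
  swap
  · have hzero : ∀ e : Fin 3 → Bool, (∑ᶠ M ∈ Orb, ({a : Fin 3 → ℤ |
        IsVertexLattice σ ϖ (Matrix.diagonal fun j => if e j then c else (1 : K)) tv (mapGL (diagGLUnits fun j => ϖu ^ a j) M) ∧
          Λ (mapGL (diagGLUnits fun j => ϖu ^ a j) M) (fun j => if e j then c else (1 : K))} : Set _).ncard) = 0 := by
      intro e
      apply finsum_mem_of_eqOn_zero
      rintro M ⟨u, -, rfl⟩
      have hempty : ({a : Fin 3 → ℤ | IsVertexLattice σ ϖ (Matrix.diagonal fun j => if e j then c else (1 : K)) tv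
            (mapGL (diagGLUnits fun j => ϖu ^ a j) (mapGL (diagGLUnits u) M₀)) ∧
          Λ (mapGL (diagGLUnits fun j => ϖu ^ a j) (mapGL (diagGLUnits u) M₀)) (fun j => if e j then c else (1 : K))} : Set _) = ∅ := by
        ext a
        simp only [Set.mem_setOf_eq, Set.mem_empty_iff_false, iff_false]
        rintro ⟨ha, -⟩
        rw [← mapGL_mul, ← map_mul, isVertexLattice_diagonal_mapGL_diagGLUnits_iff] at ha
        refine hex ⟨_, fun j => ⟨?_, ?_⟩, ha⟩
        · have hfix : σ (if e j then c else (1 : K)) = if e j then c else 1 := by by_cases h : e j <;> simp [h, hσc]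
          rw [map_mul, map_mul, hfix, hσ, mul_comm (σ _) (_ : K)]
        · have hne' : (if e j then c else (1 : K)) ≠ 0 := by by_cases h : e j <;> simp [h, hc0]
          exact mul_ne_zero hne' (mul_ne_zero (Units.ne_zero _) ((map_ne_zero σ).2 (Units.ne_zero _)))
      change ({a : Fin 3 → ℤ | IsVertexLattice σ ϖ (Matrix.diagonal fun j => if e j then c else (1 : K)) tv
            (mapGL (diagGLUnits fun j => ϖu ^ a j) (mapGL (diagGLUnits u) M₀)) ∧
          Λ (mapGL (diagGLUnits fun j => ϖu ^ a j) (mapGL (diagGLUnits u) M₀)) (fun j => if e j then c else (1 : K))} : Set _).ncard = 0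
      rw [hempty, Set.ncard_empty]
    simp only [hzero, Nat.cast_zero, mul_zero, Finset.sum_const_zero, zero_mul]
    rw [labelledOddCount_eq_zero_of_not_exists σ ϖ tv i Λ M₀ hex, Int.cast_zero, mul_zero]
  obtain ⟨D₁, hD₁, hV₁⟩ := hex
  -- THE LETTERS: `cU`, `c^{e}`, `D₁ = N(ϖu^{a₀})·w`, `s(e,u) = c^e·N(u)·w⁻¹`, `pol(e,u) = D₁·s(e,u)`, `cls(e,u) = pol(e,u)·N(S̃)`, `H₀ = 𝒯 ⊓ N⁻¹(N S̃)`
  set cU : Kˣ := Units.mk0 c hc0 with hcUdef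
  have hcU : (cU : K) = c := rfl
  set cvec : (Fin 3 → Bool) → (Fin 3 → Kˣ) := fun e j => if e j then cU else 1 with hcvecdef
  have hcvec : ∀ e, cvec e = fun j => if e j then cU else 1 := fun e => by rw [hcvecdef]
  obtain ⟨a₀, w, hwU, hD₁w⟩ := exists_zpow_fixedUnit_decomposition hσ hvσ hϖ ϖu hϖu hσc hcv hdich D₁ hD₁
  set sEU : (Fin 3 → Bool) → (Fin 3 → Kˣ) → (Fin 3 → Kˣ) := fun e u => cvec e * unitNormMap σ 3 u * w⁻¹ with hsEUdef
  have hsEU : ∀ e u, sEU e u = cvec e * unitNormMap σ 3 u * w⁻¹ := fun e u => by rw [hsEUdef]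
  set pol : (Fin 3 → Bool) → (Fin 3 → Kˣ) → (Fin 3 → K) := fun e u j => D₁ j * ((sEU e u j : Kˣ) : K) with hpoldef
  have hpol : ∀ e u j, pol e u j = D₁ j * ((sEU e u j : Kˣ) : K) := fun e u j => by rw [hpoldef]
  set NS : Subgroup (Fin 3 → Kˣ) := (unitStabilizer M₀).map (unitNormMap σ 3) with hNSdef
  set H₀ : Subgroup (Fin 3 → Kˣ) := unitTorus K 3 ⊓ NS.comap (unitNormMap σ 3) with hH₀
  set cls : (Fin 3 → Bool) → (Fin 3 → Kˣ) → Set (Fin 3 → K) := fun e u =>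
    {D' | ∃ n ∈ NS, ∀ j, D' j = pol e u j * ((n j : Kˣ) : K)} with hclsdef
  have hcls : ∀ e u, cls e u = {D' | ∃ n ∈ (unitStabilizer M₀).map (unitNormMap σ 3), ∀ j, D' j = pol e u j * ((n j : Kˣ) : K)} :=
    fun e u => by rw [hclsdef]
  have hNSle : NS ≤ fixedUnitStabilizer σ M₀ := map_unitNormMap_unitStabilizer_le hσ tv hcoset hD₁ hV₁
  have hStH₀ : unitStabilizer M₀ ≤ H₀ := by
    intro t ht
    refine Subgroup.mem_inf.2 ⟨(Subgroup.mem_inf.1 ht).2, ?_⟩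
    rw [Subgroup.mem_comap]
    exact Subgroup.mem_map_of_mem _ ht
  -- a good `(e₀, u₀)` stays good along `u₀·H₀`
  have hgood_mul : ∀ (e : Fin 3 → Bool) (u₀ h : Fin 3 → Kˣ), h ∈ H₀ → (sEU e u₀ ∈ fixedUnitStabilizer σ M₀ ∧ Λ M₀ (pol e u₀)) →
      (sEU e (u₀ * h) ∈ fixedUnitStabilizer σ M₀ ∧ Λ M₀ (pol e (u₀ * h))) := by
    intro e u₀ h hh hq₀
    have hNh : unitNormMap σ 3 h ∈ NS := by have := (Subgroup.mem_inf.1 hh).2; rwa [Subgroup.mem_comap] at this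
    rw [sEU_mul σ cvec sEU hsEU]
    refine ⟨(fixedUnitStabilizer σ M₀).mul_mem hq₀.1 (hNSle hNh), ?_⟩
    obtain ⟨t, ht, hth⟩ := hNh
    have hfun : pol e (u₀ * h) = fun j => pol e u₀ j * ((unitNormMap σ 3 t j : Kˣ) : K) := funext fun j => by rw [pol_mul σ cvec sEU hsEU pol hpol, hth]
    rw [hfun, label_mul_unitNormMap_iff Λ hΛ _ ht]
    exact hq₀.2
  -- Step 4 (FILE 1): per sign, the orbit sum is `#B e`
  set B : (Fin 3 → Bool) → Set (Submodule 𝒪[K] (Fin 3 → K)) := fun e =>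
    {M | ∃ u ∈ unitTorus K 3, M = mapGL (diagGLUnits u) M₀ ∧ (sEU e u ∈ fixedUnitStabilizer σ M₀ ∧ Λ M₀ (pol e u))} with hB
  have hBsub : ∀ e, B e ⊆ Orb := by
    rintro e M ⟨u, hu, rfl, -⟩; exact ⟨u, hu, rfl⟩
  have hcount : ∀ e : Fin 3 → Bool, (∑ᶠ M ∈ Orb, ({a : Fin 3 → ℤ |
      IsVertexLattice σ ϖ (Matrix.diagonal fun j => if e j then c else (1 : K)) tv (mapGL (diagGLUnits fun j => ϖu ^ a j) M) ∧
        Λ (mapGL (diagGLUnits fun j => ϖu ^ a j) M) (fun j => if e j then c else (1 : K))} : Set _).ncard) = (B e).ncard := fun e =>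
    finsum_ncard_labelledFibre_eq_ncard hσ hvσ hϖ ϖu hϖu hσc hcv cU hcU hfin tv hcoset hD₁ hV₁ hwU hD₁w Λ hΛ cvec hcvec sEU hsEU pol hpol e
  -- THE FINITE SET OF PAIRS `X = {(e, M) : M ∈ B e}` and the class map `π`
  set X : Finset ((Fin 3 → Bool) × Submodule 𝒪[K] (Fin 3 → K)) := (Finset.univ ×ˢ hfin.toFinset).filter (fun p => p.2 ∈ B p.1) with hX
  set π : (Fin 3 → Bool) × Submodule 𝒪[K] (Fin 3 → K) → Set (Fin 3 → K) := fun p =>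
    {D' | ∃ u ∈ unitTorus K 3, p.2 = mapGL (diagGLUnits u) M₀ ∧ (sEU p.1 u ∈ fixedUnitStabilizer σ M₀ ∧ Λ M₀ (pol p.1 u)) ∧ D' ∈ cls p.1 u} with hπ
  have hmemX : ∀ p, p ∈ X ↔ p.2 ∈ B p.1 := by
    intro p
    simp only [hX, Finset.mem_filter, Finset.mem_product, Finset.mem_univ, true_and, Set.Finite.mem_toFinset]
    exact ⟨fun h => h.2, fun h => ⟨hBsub p.1 h, h⟩⟩
  -- `π` on a pair represented by a good `(e, u)` is `cls e u`
  have hπ_eq : ∀ (e : Fin 3 → Bool) (u : Fin 3 → Kˣ), u ∈ unitTorus K 3 → (sEU e u ∈ fixedUnitStabilizer σ M₀ ∧ Λ M₀ (pol e u)) →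
      π (e, mapGL (diagGLUnits u) M₀) = cls e u := by
    intro e u hu hq
    ext D'
    simp only [hπ, Set.mem_setOf_eq]
    constructor
    · rintro ⟨u', hu', heq, -, hD'⟩
      have hst : u⁻¹ * u' ∈ H₀ := hStH₀ (by
        refine Subgroup.mem_inf.2 ⟨?_, (unitTorus K 3).mul_mem ((unitTorus K 3).inv_mem hu) hu'⟩
        rw [mem_latticeStabilizer_iff, map_mul, mapGL_mul, ← heq, ← mapGL_mul, ← map_mul, inv_mul_cancel, map_one, mapGL_one])
      rw [show u' = u * (u⁻¹ * u') by rw [mul_inv_cancel_left], normClass_mul_eq σ cvec sEU hsEU pol hpol cls hcls e u hst] at hD'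
      exact hD'
    · intro hD'
      exact ⟨u, hu, rfl, hq, hD'⟩
  -- the signed total as a sum over pairs
  have htotal : (∑ e : Fin 3 → Bool, ((if e i then (-1 : ℤ) else 1 : ℤ) : ℚ) * ((B e).ncard : ℚ)) =
      ∑ p ∈ X, ((if p.1 i then (-1 : ℤ) else 1 : ℤ) : ℚ) := by
    have hB_card : ∀ e, ((B e).ncard : ℚ) = ((hfin.toFinset.filter (fun M => M ∈ B e)).card : ℚ) := by
      intro e
      rw [Set.ncard_eq_toFinset_card _ (hfin.subset (hBsub e))]
      norm_cast
      congr 1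
      ext M
      simp only [Finset.mem_filter, Set.Finite.mem_toFinset]
      exact ⟨fun h => ⟨hBsub e h, h⟩, fun h => h.2⟩
    rw [hX, Finset.sum_filter, Finset.sum_product]
    refine Finset.sum_congr rfl fun e _ => ?_
    rw [hB_card e, Finset.card_eq_sum_ones, Nat.cast_sum, Finset.mul_sum, Finset.sum_filter]
    refine Finset.sum_congr rfl fun M _ => ?_
    by_cases h : M ∈ B e
    · rw [if_pos h, if_pos h]; simp
    · rw [if_neg h, if_neg h]
  -- fibres of `π`: over `cls e₀ u₀` the pairs are `{e₀} × (u₀·H₀)·M₀`, of size `[H₀ : S̃]`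
  have hfibre : ∀ (e₀ : Fin 3 → Bool) (u₀ : Fin 3 → Kˣ), u₀ ∈ unitTorus K 3 → (sEU e₀ u₀ ∈ fixedUnitStabilizer σ M₀ ∧ Λ M₀ (pol e₀ u₀)) →
      (X.filter fun p => π p = cls e₀ u₀) = ({e₀} : Finset (Fin 3 → Bool)) ×ˢ
        (hfin.subset (hBsub e₀)).toFinset.filter (fun M => M ∈ {M | ∃ h ∈ H₀, M = mapGL (diagGLUnits (u₀ * h)) M₀}) := by
    intro e₀ u₀ hu₀ hq₀
    ext ⟨e, M⟩
    simp only [Finset.mem_filter, hmemX, Finset.mem_product, Finset.mem_singleton, Set.Finite.mem_toFinset, Set.mem_setOf_eq]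
    constructor
    · rintro ⟨hMB, hπM⟩
      obtain ⟨u, hu, rfl, hq⟩ := hMB
      rw [hπ_eq e u hu hq] at hπM
      have hmem : pol e u ∈ cls e₀ u₀ := by rw [← hπM, hcls]; exact ⟨1, Subgroup.one_mem _, fun j => by simp⟩
      obtain ⟨rfl, hh⟩ := eq_and_mem_of_pol_mem_normClass hvσ hσc hcv hc hdich cU hcU hD₁ cvec hcvec sEU hsEU pol hpol cls hcls hu₀ hu hmem
      exact ⟨rfl, ⟨u, hu, rfl, hq⟩, u₀⁻¹ * u, hh, by rw [mul_inv_cancel_left]⟩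
    · rintro ⟨rfl, hMB, h, hh, rfl⟩
      have hu : u₀ * h ∈ unitTorus K 3 := (unitTorus K 3).mul_mem hu₀ (Subgroup.mem_inf.1 hh).1
      exact ⟨hMB, by rw [hπ_eq e _ hu (hgood_mul e u₀ h hh hq₀), normClass_mul_eq σ cvec sEU hsEU pol hpol cls hcls e u₀ hh]⟩
  have hfibre_card : ∀ (e₀ : Fin 3 → Bool) (u₀ : Fin 3 → Kˣ), u₀ ∈ unitTorus K 3 → (sEU e₀ u₀ ∈ fixedUnitStabilizer σ M₀ ∧ Λ M₀ (pol e₀ u₀)) →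
      (X.filter fun p => π p = cls e₀ u₀).card = (latticeStabilizer M₀).relIndex H₀ := by
    intro e₀ u₀ hu₀ hq₀
    have hsubB : {M | ∃ h ∈ H₀, M = mapGL (diagGLUnits (u₀ * h)) M₀} ⊆ B e₀ := by
      rintro M ⟨h, hh, rfl⟩
      exact ⟨u₀ * h, (unitTorus K 3).mul_mem hu₀ (Subgroup.mem_inf.1 hh).1, rfl, hgood_mul e₀ u₀ h hh hq₀⟩
    rw [hfibre e₀ u₀ hu₀ hq₀, Finset.card_product, Finset.card_singleton, one_mul, ← ncard_translate_subgroup_orbit_eq_relIndex H₀ u₀ M₀,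
      Set.ncard_eq_toFinset_card _ ((hfin.subset (hBsub e₀)).subset hsubB)]
    congr 1
    ext M
    simp only [Finset.mem_filter, Set.Finite.mem_toFinset, Set.mem_setOf_eq, and_iff_right_iff_imp]
    exact fun hM => hsubB hM
  -- the sum over pairs, fibrewise over the image of `π`
  have hsum_fibre : (∑ p ∈ X, ((if p.1 i then (-1 : ℤ) else 1 : ℤ) : ℚ)) =
      ∑ C ∈ X.image π, (((latticeStabilizer M₀).relIndex H₀ : ℕ) : ℚ) * (classLabelSign σ i (Λ M₀) C : ℚ) := by
    rw [← Finset.sum_fiberwise_of_maps_to (g := π) (t := X.image π) (fun p hp => Finset.mem_image_of_mem π hp)]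
    refine Finset.sum_congr rfl fun C hC => ?_
    obtain ⟨⟨e₀, M⟩, hpX, rfl⟩ := Finset.mem_image.1 hC
    obtain ⟨u₀, hu₀, rfl, hq₀⟩ := (hmemX _).1 hpX
    rw [hπ_eq e₀ u₀ hu₀ hq₀]
    have hconst : ∀ p ∈ X.filter (fun p => π p = cls e₀ u₀), ((if p.1 i then (-1 : ℤ) else 1 : ℤ) : ℚ) = ((if e₀ i then (-1 : ℤ) else 1 : ℤ) : ℚ) := by
      intro p hp
      rw [hfibre e₀ u₀ hu₀ hq₀] at hp
      simp only [Finset.mem_product, Finset.mem_singleton] at hp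
      rw [hp.1]
    rw [Finset.sum_congr rfl hconst, Finset.sum_const, hfibre_card e₀ u₀ hu₀ hq₀, nsmul_eq_mul]
    congr 1
    have hall : ∀ D' ∈ cls e₀ u₀, Λ M₀ D' ∧ normSign σ (D' i) = (if e₀ i then (-1 : ℤ) else 1) := fun D' hD' =>
      label_and_normSign_of_mem_normClass σ ϖu hcv hc cU hcU hD₁w Λ hΛ cvec hcvec sEU hsEU pol hpol cls hcls i hq₀.2 hD'
    by_cases h : e₀ i
    · have h' : ∀ D' ∈ cls e₀ u₀, Λ M₀ D' ∧ normSign σ (D' i) = -1 := fun D' hD' => by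
        have := hall D' hD'; rw [if_pos h] at this; exact this
      have hne : (cls e₀ u₀).Nonempty := ⟨pol e₀ u₀, by rw [hcls]; exact ⟨1, Subgroup.one_mem _, fun j => by simp⟩⟩
      rw [classLabelSign_eq_neg_one_of_forall σ i (Λ M₀) hne h']
      simp [h]
    · have h' : ∀ D' ∈ cls e₀ u₀, Λ M₀ D' ∧ normSign σ (D' i) = 1 := fun D' hD' => by
        have := hall D' hD'; rw [if_neg h] at this; exact this
      rw [classLabelSign_eq_one_of_forall σ i (Λ M₀) h']
      simp [h]
  -- the image of `π` carries the whole labelled odd count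
  have himage : (labelledOddCount σ ϖ tv i Λ M₀ : ℚ) = ∑ C ∈ X.image π, (classLabelSign σ i (Λ M₀) C : ℚ) := by
    rw [labelledOddCount_eq, finsum_mem_eq_sum_of_inter_support_eq (s := polarisationNormClasses σ ϖ tv M₀) (t := X.image π)]
    · push_cast; rfl
    · ext C
      simp only [Set.mem_inter_iff, Function.mem_support, Finset.mem_coe, Finset.mem_image, ne_eq]
      constructor
      · rintro ⟨hC, hne⟩
        obtain ⟨e, u, hu, hs, rfl, hmem⟩ :=
          exists_rep_of_mem_polarisationNormClasses hvσ hσc hcv hc hdich cU hcU tv hcoset hD₁ hV₁ hwU cvec hcvec sEU hsEU pol hpol cls hcls hC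
        by_cases hL : Λ M₀ (pol e u)
        · exact ⟨⟨(e, mapGL (diagGLUnits u) M₀), (hmemX _).2 ⟨u, hu, rfl, hs, hL⟩, hπ_eq e u hu ⟨hs, hL⟩⟩, hne⟩
        · exact absurd (classLabelSign_eq_zero_of_not σ i (Λ M₀) hmem hL) hne
      · rintro ⟨⟨p, hpX, rfl⟩, hne⟩
        obtain ⟨u, hu, hp2, hq⟩ := (hmemX _).1 hpX
        refine ⟨?_, hne⟩
        have hπp : π p = cls p.1 u := by
          have := hπ_eq p.1 u hu hq
          rw [← hp2] at this
          exact this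
        rw [hπp]
        exact normClass_mem_polarisationNormClasses σ tv hcoset hD₁ hV₁ sEU pol hpol cls hcls p.1 hq.1
  -- THE INDEX IDENTITY (FILE 2) and the assembly
  have hidx := relIndex_mul_relIndex_map_unitStabilizer_eq hσ hvσ hσc hcv hc hdich cU hcU M₀
  have hLHS : (∑ e : Fin 3 → Bool, ((if e i then (-1 : ℤ) else 1 : ℤ) : ℚ) *
        ((∑ᶠ M ∈ Orb, ({a : Fin 3 → ℤ | IsVertexLattice σ ϖ (Matrix.diagonal fun j => if e j then c else (1 : K)) tv
              (mapGL (diagGLUnits fun j => ϖu ^ a j) M) ∧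
            Λ (mapGL (diagGLUnits fun j => ϖu ^ a j) M) (fun j => if e j then c else (1 : K))} : Set _).ncard : ℕ) : ℚ)) =
      (((latticeStabilizer M₀).relIndex H₀ : ℕ) : ℚ) * (labelledOddCount σ ϖ tv i Λ M₀ : ℚ) := by
    rw [Finset.sum_congr rfl fun e _ => by rw [hcount e], htotal, hsum_fibre, himage, Finset.mul_sum]
  rw [hLHS]
  have hidxQ : (((latticeStabilizer M₀).relIndex H₀ : ℕ) : ℚ) * ((NS.relIndex (fixedUnitTorus σ 3) : ℕ) : ℚ) =
      8 * (((unitStabilizer M₀).relIndex (unitTorus K 3) : ℕ) : ℚ) := by exact_mod_cast hidx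
  calc (((latticeStabilizer M₀).relIndex H₀ : ℕ) : ℚ) * (labelledOddCount σ ϖ tv i Λ M₀ : ℚ) * ((NS.relIndex (fixedUnitTorus σ 3) : ℕ) : ℚ)
      = ((((latticeStabilizer M₀).relIndex H₀ : ℕ) : ℚ) * ((NS.relIndex (fixedUnitTorus σ 3) : ℕ) : ℚ)) * (labelledOddCount σ ϖ tv i Λ M₀ : ℚ) := by ring
    _ = 8 * (((unitStabilizer M₀).relIndex (unitTorus K 3) : ℕ) : ℚ) * (labelledOddCount σ ϖ tv i Λ M₀ : ℚ) := by rw [hidxQ]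

end Summit.HodgeConjecture.HodgeConjecture.Cruxes.H413.F0P3cDyRamDiagonalLabelledOddFibreCount

end
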